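import Literature.ModelTheory.ExponentialFields.ExpPolyJacobian
import Literature.ModelTheory.ExponentialFields.ExpPolyDictionary
import HarnessLib

/-!
# The auxiliary square system `H = (M₁, …, M_N, x_{N+1} · p₀ − 1)` of the Schanuel step

Family `periods` (periods.S27), topic `Literature/ModelTheory/ExponentialFields`: node (B3.4) of the
decomposition of the conditional half of Macintyre–Wilkie's theorem
(`Literature.ModelTheory.ExponentialFields.macintyreWilkie_existential_of_schanuelProperty`).

Jones–Servi 2011 (transposing Macintyre–Wilkie 1996, §5), proof of Thm. 3.11: "Let
`hᵢ(x̄) := pᵢ(x̄, x̄^α) ∈ M_n(ℤ[α])` for `i = 0, …, n` and `h_{n+1}(x̄, x_{n+1}) := x_{n+1} h₀(x̄) − 1`.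
Let `H := (h₁, …, h_{n+1})`. Using the fact that `ā ∈ V^{reg}(F)`, we easily see that
`(ā, h₀(ā)⁻¹) ∈ ℝⁿ⁺¹` is a regular solution of the system `H = 0` … hence, by Theorem 3.7, for every
model `K` of `T` there exists `(γ̄, γ_{n+1}) ∈ Kⁿ⁺¹` which is a regular solution of `H = 0` in `K`.
In particular, `K ⊨ ⋀ hᵢ(γ̄) = 0 ∧ h₀(γ̄) ≠ 0` (1)".  For `exp`:

* `ExpPoly.auxSystem M p₀ : Fin (N+1) → ℤ[x₁…x_{N+1}, y₁…y_{N+1}]` — the lifted `Mₗ` and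
  `x_{N+1} · p₀ − 1`;
* `ExpPoly.expAEval E P γ` — the value `P(γ̄, E(γ̄))` in any commutative ring with a map `E`
  (in `ℝ` with `E = exp` this is `expEval`), and **(1) in any such ring**:
  `ExpPoly.aux_zero_iff` — `H(γ̄, γ_{N+1}) = 0 ↔ (∀ l, Mₗ(γ̄) = 0) ∧ γ_{N+1} · p₀(γ̄) = 1`;
* in `ℝ`: `ExpPoly.det_expJac_auxSystem` — the Jacobian of `H` at `(ā, c)` is `p₀(ā) · det JM(ā)`
  (expansion along the last column), hence **`ExpPoly.isNonsingularZero_auxSystem`**: if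
  `Mₗ(ā) = 0`, `p₀(ā) ≠ 0` and `det JM(ā) ≠ 0`, then `(ā, p₀(ā)⁻¹)` is a non-singular zero
  (`ExpPolyCode.IsNonsingularZero`, `LastRootConjecture.lean`) of the system of codes
  `ExpPolyCode.ofMvPoly` of `H` — the input of the Newton scheme.

Everything here is proved.

## References

* G. O. Jones, T. Servi, *On the decidability of the real field with a generic power function*,
  J. Symb. Log. 76 (2011), Thm. 3.11 (proof).
* A. Macintyre, A. J. Wilkie, *On the decidability of the real exponential field* (1996), §5.
-/

noncomputable section

open scoped BigOperators Matrix
open MvPolynomial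

namespace Literature.ModelTheory.ExponentialFields

namespace ExpPoly

variable {N : ℕ}

/-! ### Evaluation at `(γ̄, E γ̄)` in a commutative ring -/

/-- The value `P(γ̄, E(γ̄))` of `P ∈ ℤ[x̄, ȳ]` in a commutative ring `K` with a map `E : K → K`. [folklore] -/
def expAEval {K : Type*} [CommRing K] (E : K → K) (P : MvPolynomial (Fin N ⊕ Fin N) ℤ)
    (γ : Fin N → K) : K :=
  MvPolynomial.aeval (Sum.elim γ (E ∘ γ)) P

/-- In `ℝ` with `E = exp`, `expAEval = expEval`. [folklore] -/
theorem expAEval_real (P : MvPolynomial (Fin N ⊕ Fin N) ℤ) (x : Fin N → ℝ) :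
    expAEval Real.exp P x = expEval P x := rfl

/-! ### The auxiliary system -/

/-- the embedding of the variables `(x̄, ȳ)` of `ℤ[x₁…x_N, y₁…y_N]` into those of
`ℤ[x₁…x_{N+1}, y₁…y_{N+1}]` [folklore] -/
def embVar : Fin N ⊕ Fin N → Fin (N + 1) ⊕ Fin (N + 1) := Sum.map Fin.castSucc Fin.castSucc

/-- `embVar` is injective. [folklore] -/
theorem embVar_injective : Function.Injective (embVar (N := N)) :=
  Sum.map_injective.2 ⟨Fin.castSucc_injective N, Fin.castSucc_injective N⟩

/-- lifting a polynomial to one more pair of variables [folklore] -/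
def liftP (P : MvPolynomial (Fin N ⊕ Fin N) ℤ) : MvPolynomial (Fin (N + 1) ⊕ Fin (N + 1)) ℤ :=
  rename embVar P

/-- the last polynomial `x_{N+1} · p₀ − 1` [folklore] -/
def auxLast (p₀ : MvPolynomial (Fin N ⊕ Fin N) ℤ) : MvPolynomial (Fin (N + 1) ⊕ Fin (N + 1)) ℤ :=
  X (Sum.inl (Fin.last N)) * liftP p₀ - 1

/-- **The auxiliary square system** `H = (M₁, …, M_N, x_{N+1} · p₀ − 1)` in `N + 1` unknowns. [cite: JonesServi2011, Thm. 3.11 (proof)] -/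
def auxSystem (M : Fin N → MvPolynomial (Fin N ⊕ Fin N) ℤ) (p₀ : MvPolynomial (Fin N ⊕ Fin N) ℤ) :
    Fin (N + 1) → MvPolynomial (Fin (N + 1) ⊕ Fin (N + 1)) ℤ :=
  Fin.lastCases (auxLast p₀) fun l => liftP (M l)

/-- The rows `l < N` of the auxiliary system. [folklore] -/
@[simp] theorem auxSystem_castSucc (M : Fin N → MvPolynomial (Fin N ⊕ Fin N) ℤ)
    (p₀ : MvPolynomial (Fin N ⊕ Fin N) ℤ) (l : Fin N) :
    auxSystem M p₀ (Fin.castSucc l) = liftP (M l) := by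
  simp [auxSystem]

/-- The last row of the auxiliary system. [folklore] -/
@[simp] theorem auxSystem_last (M : Fin N → MvPolynomial (Fin N ⊕ Fin N) ℤ)
    (p₀ : MvPolynomial (Fin N ⊕ Fin N) ℤ) : auxSystem M p₀ (Fin.last N) = auxLast p₀ := by
  simp [auxSystem]

section AnyRing

variable {K : Type*} [CommRing K] (E : K → K)

/-- Values of lifted polynomials: `(liftP P)(γ̄) = P(γ̄|_N)`. [folklore] -/
theorem expAEval_liftP (P : MvPolynomial (Fin N ⊕ Fin N) ℤ) (γ : Fin (N + 1) → K) :
    expAEval E (liftP P) γ = expAEval E P (γ ∘ Fin.castSucc) := by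
  rw [expAEval, liftP, aeval_rename, expAEval]
  have : (Sum.elim γ (E ∘ γ)) ∘ embVar = Sum.elim (γ ∘ Fin.castSucc) (E ∘ (γ ∘ Fin.castSucc)) := by
    funext v; rcases v with i | i <;> rfl
  rw [this]

/-- Value of the last polynomial. [folklore] -/
theorem expAEval_auxLast (p₀ : MvPolynomial (Fin N ⊕ Fin N) ℤ) (γ : Fin (N + 1) → K) :
    expAEval E (auxLast p₀) γ = γ (Fin.last N) * expAEval E p₀ (γ ∘ Fin.castSucc) - 1 := by
  rw [← expAEval_liftP E p₀ γ]
  simp only [expAEval, auxLast, map_sub, map_mul, map_one, aeval_X, Sum.elim_inl]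

/-- **(1) of Jones–Servi's proof, in any commutative ring with an `E`**: a zero `(γ̄, γ_{N+1})` of
the auxiliary system gives `Mₗ(γ̄) = 0` for all `l` and `γ_{N+1} · p₀(γ̄) = 1` (in particular
`p₀(γ̄) ≠ 0`), and conversely. [cite: JonesServi2011, Thm. 3.11 (proof)] -/
theorem aux_zero_iff (M : Fin N → MvPolynomial (Fin N ⊕ Fin N) ℤ)
    (p₀ : MvPolynomial (Fin N ⊕ Fin N) ℤ) (γ : Fin (N + 1) → K) :
    (∀ i, expAEval E (auxSystem M p₀ i) γ = 0) ↔
      (∀ l, expAEval E (M l) (γ ∘ Fin.castSucc) = 0) ∧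
        γ (Fin.last N) * expAEval E p₀ (γ ∘ Fin.castSucc) = 1 := by
  constructor
  · intro h
    refine ⟨fun l => ?_, ?_⟩
    · have := h (Fin.castSucc l)
      rwa [auxSystem_castSucc, expAEval_liftP] at this
    · have := h (Fin.last N)
      rw [auxSystem_last, expAEval_auxLast] at this
      exact sub_eq_zero.1 this
  · rintro ⟨hM, hp⟩ i
    refine Fin.lastCases ?_ (fun l => ?_) i
    · rw [auxSystem_last, expAEval_auxLast, hp, sub_self]
    · rw [auxSystem_castSucc, expAEval_liftP, hM l]

/-- The target identity transfers: if `p₀ · g = Σₗ bₗ Mₗ` in `ℤ[x̄, ȳ]` and `(γ̄, γ_{N+1})` is a zero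
of the auxiliary system, then `g(γ̄, E γ̄) = 0` ("Putting equations (1) and (4) together, we
obtain that `K ⊨ g(γ̄) = 0`"). [cite: JonesServi2011, Thm. 3.11 (proof)] -/
theorem expAEval_eq_zero_of_identity {M : Fin N → MvPolynomial (Fin N ⊕ Fin N) ℤ}
    {p₀ g : MvPolynomial (Fin N ⊕ Fin N) ℤ} {b : Fin N → MvPolynomial (Fin N ⊕ Fin N) ℤ}
    (hid : p₀ * g = ∑ l, b l * M l) {γ : Fin (N + 1) → K}
    (hγ : ∀ i, expAEval E (auxSystem M p₀ i) γ = 0) :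
    expAEval E g (γ ∘ Fin.castSucc) = 0 := by
  obtain ⟨hM, hp⟩ := (aux_zero_iff E M p₀ γ).1 hγ
  simp only [expAEval] at hM hp ⊢
  have h := congrArg (MvPolynomial.aeval (Sum.elim (γ ∘ Fin.castSucc) (E ∘ (γ ∘ Fin.castSucc)))) hid
  simp only [map_mul, map_sum, hM, mul_zero, Finset.sum_const_zero] at h
  -- `p₀(γ̄) g(γ̄) = 0` with `γ_{N+1} p₀(γ̄) = 1`
  calc MvPolynomial.aeval (Sum.elim (γ ∘ Fin.castSucc) (E ∘ (γ ∘ Fin.castSucc))) g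
      = (γ (Fin.last N) * MvPolynomial.aeval (Sum.elim (γ ∘ Fin.castSucc) (E ∘ (γ ∘ Fin.castSucc))) p₀) *
          MvPolynomial.aeval (Sum.elim (γ ∘ Fin.castSucc) (E ∘ (γ ∘ Fin.castSucc))) g := by rw [hp, one_mul]
    _ = γ (Fin.last N) * (MvPolynomial.aeval (Sum.elim (γ ∘ Fin.castSucc) (E ∘ (γ ∘ Fin.castSucc))) p₀ *
          MvPolynomial.aeval (Sum.elim (γ ∘ Fin.castSucc) (E ∘ (γ ∘ Fin.castSucc))) g) := by ring
    _ = 0 := by rw [h, mul_zero]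

end AnyRing

/-! ### The non-singular real zero `(ā, p₀(ā)⁻¹)` -/

/-- Partial derivatives of lifted polynomials at `(ā, c)`, directions `k < N`. [folklore] -/
theorem expPD_castSucc_liftP (P : MvPolynomial (Fin N ⊕ Fin N) ℤ) (y : Fin (N + 1) → ℝ) (k : Fin N) :
    expPD (Fin.castSucc k) (liftP P) y = expPD k P (y ∘ Fin.castSucc) := by
  have h1 : pderiv (Sum.inl (Fin.castSucc k)) (liftP P) = liftP (pderiv (Sum.inl k) P) := by
    rw [liftP, liftP, ← pderiv_rename embVar_injective]; rfl
  have h2 : pderiv (Sum.inr (Fin.castSucc k)) (liftP P) = liftP (pderiv (Sum.inr k) P) := by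
    rw [liftP, liftP, ← pderiv_rename embVar_injective]; rfl
  rw [expPD, expPD, h1, h2, ← expAEval_real, ← expAEval_real, expAEval_liftP, expAEval_liftP]
  rfl

/-- `embVar` misses the new variables. [folklore] -/
theorem embVar_ne_last (w : Fin N ⊕ Fin N) :
    embVar w ≠ Sum.inl (Fin.last N) ∧ embVar w ≠ Sum.inr (Fin.last N) := by
  rcases w with i | i <;> simp [embVar, Fin.castSucc_ne_last]

/-- Lifted polynomials do not involve `x_{N+1}`. [folklore] -/
theorem pderiv_inl_last_liftP (P : MvPolynomial (Fin N ⊕ Fin N) ℤ) :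
    pderiv (Sum.inl (Fin.last N)) (liftP P) = 0 := by
  rw [liftP]
  induction P using MvPolynomial.induction_on with
  | C a => simp
  | add p q hp hq => rw [map_add, map_add, hp, hq, add_zero]
  | mul_X p w hp =>
    rw [map_mul, Derivation.leibniz, hp, smul_zero, add_zero, rename_X, pderiv_X,
      Pi.single_apply, if_neg (embVar_ne_last w).1, smul_zero]

/-- Lifted polynomials do not involve `y_{N+1}`. [folklore] -/
theorem pderiv_inr_last_liftP (P : MvPolynomial (Fin N ⊕ Fin N) ℤ) :
    pderiv (Sum.inr (Fin.last N)) (liftP P) = 0 := by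
  rw [liftP]
  induction P using MvPolynomial.induction_on with
  | C a => simp
  | add p q hp hq => rw [map_add, map_add, hp, hq, add_zero]
  | mul_X p w hp =>
    rw [map_mul, Derivation.leibniz, hp, smul_zero, add_zero, rename_X, pderiv_X,
      Pi.single_apply, if_neg (embVar_ne_last w).2, smul_zero]

/-- Lifted polynomials do not depend on the new variables: zero partial derivative in the last
direction. [folklore] -/
theorem expPD_last_liftP (P : MvPolynomial (Fin N ⊕ Fin N) ℤ) (y : Fin (N + 1) → ℝ) :
    expPD (Fin.last N) (liftP P) y = 0 := by
  rw [expPD, pderiv_inl_last_liftP, pderiv_inr_last_liftP]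
  simp

/-- Partial derivative of the last polynomial in the last direction: `p₀(ā)`
(`∂_x(x · L) = L + x ∂_x L`, `∂_y(x · L) = x ∂_y L`, and `∂ L = 0` in the last direction). [folklore] -/
theorem expPD_last_auxLast (p₀ : MvPolynomial (Fin N ⊕ Fin N) ℤ) (y : Fin (N + 1) → ℝ) :
    expPD (Fin.last N) (auxLast p₀) y = expEval p₀ (y ∘ Fin.castSucc) := by
  have hD1 : pderiv (Sum.inl (Fin.last N)) (auxLast p₀) = liftP p₀ := by
    rw [auxLast, map_sub, Derivation.map_one_eq_zero, Derivation.leibniz, pderiv_inl_last_liftP, smul_zero,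
      zero_add, pderiv_X, Pi.single_eq_same, smul_eq_mul, mul_one, sub_zero]
  have hD2 : pderiv (Sum.inr (Fin.last N)) (auxLast p₀) = 0 := by
    rw [auxLast, map_sub, Derivation.map_one_eq_zero, Derivation.leibniz, pderiv_inr_last_liftP, smul_zero,
      zero_add, pderiv_X, Pi.single_apply, if_neg Sum.inl_ne_inr, smul_zero, sub_zero]
  rw [expPD, hD1, hD2, expEval_zero, mul_zero, add_zero, ← expAEval_real, expAEval_liftP, expAEval_real]

/-- **The Jacobian determinant of the auxiliary system** at any point `(ā, c)`:
`det JH(ā, c) = p₀(ā) · det JM(ā)` (expansion along the last column, whose only nonzero entry is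
`∂_{x_{N+1}}(x_{N+1} p₀ − 1) = p₀(ā)`). [cite: JonesServi2011, Thm. 3.11 (proof)] -/
theorem det_expJac_auxSystem (M : Fin N → MvPolynomial (Fin N ⊕ Fin N) ℤ)
    (p₀ : MvPolynomial (Fin N ⊕ Fin N) ℤ) (y : Fin (N + 1) → ℝ) :
    (expJac (auxSystem M p₀) y).det = expEval p₀ (y ∘ Fin.castSucc) * (expJac M (y ∘ Fin.castSucc)).det := by
  rw [Matrix.det_succ_column _ (Fin.last N), Fin.sum_univ_castSucc]
  have hcol : ∀ l : Fin N, expJac (auxSystem M p₀) y (Fin.castSucc l) (Fin.last N) = 0 := fun l => by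
    rw [expJac, Matrix.of_apply, auxSystem_castSucc, expPD_last_liftP]
  simp only [hcol, mul_zero, zero_mul, Finset.sum_const_zero, zero_add]
  have hlast : expJac (auxSystem M p₀) y (Fin.last N) (Fin.last N) = expEval p₀ (y ∘ Fin.castSucc) := by
    rw [expJac, Matrix.of_apply, auxSystem_last, expPD_last_auxLast]
  have hsub : (expJac (auxSystem M p₀) y).submatrix (Fin.last N).succAbove (Fin.last N).succAbove =
      expJac M (y ∘ Fin.castSucc) := by
    ext l k
    simp only [Matrix.submatrix_apply, Fin.succAbove_last, expJac, Matrix.of_apply, auxSystem_castSucc,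
      expPD_castSucc_liftP]
  rw [hlast, hsub, Fin.val_last, ← two_mul, pow_mul, neg_one_sq, one_pow, one_mul]

/-- **`(ā, p₀(ā)⁻¹)` is a non-singular zero of the auxiliary system** (as a system of
exponential-polynomial codes, `ExpPolyCode.IsNonsingularZero`), provided `Mₗ(ā) = 0`,
`p₀(ā) ≠ 0` and `det JM(ā) ≠ 0`. [cite: JonesServi2011, Thm. 3.11 (proof)] -/
theorem isNonsingularZero_auxSystem (M : Fin N → MvPolynomial (Fin N ⊕ Fin N) ℤ)
    (p₀ : MvPolynomial (Fin N ⊕ Fin N) ℤ) {a : Fin N → ℝ} (hM : ∀ l, expEval (M l) a = 0)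
    (hp₀ : expEval p₀ a ≠ 0) (hJ : (expJac M a).det ≠ 0) :
    ExpPolyCode.IsNonsingularZero (N + 1)
      (List.ofFn fun i => ExpPolyCode.ofMvPoly (N + 1) (auxSystem M p₀ i))
      (Fin.snoc a (expEval p₀ a)⁻¹) := by
  set y : Fin (N + 1) → ℝ := Fin.snoc a (expEval p₀ a)⁻¹ with hy
  have hya : y ∘ Fin.castSucc = a := funext fun i => by simp [hy]
  have hsys : ExpPolyCode.sysMap (N + 1) (List.ofFn fun i => ExpPolyCode.ofMvPoly (N + 1) (auxSystem M p₀ i)) =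
      fun x i => expEval (auxSystem M p₀ i) x := by
    funext x i
    rw [ExpPolyCode.sysMap, List.getD_eq_getElem?_getD, List.getElem?_ofFn]
    simp only [i.is_lt, ↓reduceDIte, Option.getD_some, Fin.eta, ExpPolyCode.eval_ofMvPoly]
    rfl
  refine ⟨by simp, ?_, ?_⟩
  · rw [hsys]
    funext i
    have : ∀ i, expAEval Real.exp (auxSystem M p₀ i) y = 0 :=
      (aux_zero_iff Real.exp M p₀ y).2 ⟨by simpa [expAEval_real, hya] using hM, by
        rw [expAEval_real, hya]; simp [hy, inv_mul_cancel₀ hp₀]⟩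
    exact this i
  · rw [hsys, det_fderiv_expEval_pi, det_expJac_auxSystem, hya]
    exact mul_ne_zero hp₀ hJ

end ExpPoly

end Literature.ModelTheory.ExponentialFields

end
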